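import Summits.AtomisticToContinuum.HydrodynamicLimit.Theorems.OneFlightGossipEngineEnergyCurrentTailsPedigreeObjects
import Summits.AtomisticToContinuum.HydrodynamicLimit.Theorems.OneFlightGossipEngineEnergyCurrentTailsLevelCensusStatics
import HarnessLib

/-!
# Gaussian facts of the local Gibbs datum (stub `stub_initialEnergyTails` of the line
# `pedigree-perpetuity`, crux `EnergyCurrentTails`, stmt-AtomisticToContinuum-9235)

Stub worker file for the registered stub `stub_initialEnergyTails : InitialEnergyTails` of the line
lead's skeleton `Cruxes/EnergyCurrentTails/Lines/pedigree_perpetuity.lean` (vocabulary in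
`…Theorems.OneFlightGossipEngineEnergyCurrentTailsPedigreeObjects`; primary crux decl
`Summit.AtomisticToContinuum.HydrodynamicLimit.Theses.WarmColdDichotomy.EnergyCurrentTails`).

**Statement** (`InitialEnergyTails`).  For continuous profiles `a₀, θ₀ > 0`, `u₀` there are
`Θ* > 0`, `ē, C ≥ 0` such that for all `σ ∈ (0, 1/2]`, `N`, flows `Φ` and `x ≥ 0`, under
`λ_N = localGibbsLaw σ a₀ u₀ θ₀ N Φ`:
(0) `E Σ_l ‖v_l‖² ≤ ē (N+1)`; (1) `E Σ_l ‖v_l‖² 𝟙{x ≤ ‖v_l‖²} ≤ C (N+1) e^{−x/Θ*}`;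
(2) `P(ē (N+1) + x ≤ Σ_l ‖v_l‖²) ≤ e^{−x/Θ*}`.

**Proof.**  Everything is read off the exponential velocity moments of the datum
(`EnergyCurrentTailsLevelCensus.exists_expMoment_localGibbsLaw`, Fernique + disintegration of the
local Gibbs law into positions and conditionally independent Gaussian velocities): there are
`α₀ > 0`, `K ≥ 1` with `E e^{α₀‖v_l‖²} ≤ K` per particle and `E ∏_l e^{α₀‖v_l‖²} ≤ K^{N+1}`,
uniformly in `σ ≤ 1/2`, `N`, `Φ`.  Take `Θ* = 2/α₀`, `ē = K/α₀`, `C = 2K/α₀`.  Then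
(0) `‖v‖² ≤ α₀⁻¹ e^{α₀‖v‖²}`; (1) with `β = α₀/2`, pointwise
`𝟙{x ≤ ‖v‖²}‖v‖² ≤ β⁻¹ e^{−βx} e^{2β‖v‖²}`; (2) Chernoff
`𝟙{a ≤ Σ‖v_l‖²} ≤ e^{−α₀ a} ∏_l e^{α₀‖v_l‖²}`, so `P ≤ e^{−α₀ a} K^{N+1}`, and with
`a = ē(N+1) + x`, `K ≤ e^{K}`: `e^{−α₀ a} K^{N+1} ≤ e^{−α₀ x} ≤ e^{−x/Θ*}`.

References: Spohn 1991 Part I §2.3 (local equilibrium states); Fernique 1970 (Gaussian vectors).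
-/

noncomputable section

open MeasureTheory Set Filter
open scoped ENNReal

namespace Summit.AtomisticToContinuum.HydrodynamicLimit.Theorems.EnergyCurrentTailsPedigree

open Literature.MathematicalPhysics.KineticTheory Literature.Analysis.FluidPDE
open Summit.AtomisticToContinuum.HydrodynamicLimit.Theorems.EnergyCurrentTailsLevelCensus
  (exists_expMoment_localGibbsLaw ofReal_le_inv_mul_exp)

/-! ## Pointwise Chernoff inequalities -/

/-- Tail-energy Chernoff bound: `𝟙{x ≤ ‖v‖²} ‖v‖² ≤ β⁻¹ e^{−βx} e^{2β‖v‖²}` in `ℝ≥0∞` (`β > 0`):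
on the event, `‖v‖² ≤ β⁻¹ e^{β‖v‖²}` and `1 ≤ e^{β(‖v‖² − x)}`. [folklore] -/
theorem ofReal_indicator_tail_le_exp {β : ℝ} (hβ : 0 < β) (x : ℝ) (v : V3) :
    ENNReal.ofReal (Set.indicator {v : V3 | x ≤ ‖v‖ ^ 2} (fun v => ‖v‖ ^ 2) v) ≤
      ENNReal.ofReal (β⁻¹ * Real.exp (-β * x)) *
        ENNReal.ofReal (Real.exp (2 * β * ‖v‖ ^ 2)) := by
  by_cases hv : x ≤ ‖v‖ ^ 2
  · rw [Set.indicator_of_mem (show v ∈ {v : V3 | x ≤ ‖v‖ ^ 2} from hv),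
      ← ENNReal.ofReal_mul (by positivity)]
    refine ENNReal.ofReal_le_ofReal ?_
    have h1 : ‖v‖ ^ 2 ≤ β⁻¹ * Real.exp (β * ‖v‖ ^ 2) := by
      rw [inv_mul_eq_div, le_div_iff₀ hβ]
      nlinarith [Real.add_one_le_exp (β * ‖v‖ ^ 2)]
    have h2 : Real.exp (β * ‖v‖ ^ 2) ≤ Real.exp (-β * x) * Real.exp (2 * β * ‖v‖ ^ 2) := by
      rw [← Real.exp_add]
      refine Real.exp_le_exp.2 ?_
      nlinarith [mul_nonneg hβ.le (sub_nonneg.2 hv)]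
    calc ‖v‖ ^ 2 ≤ β⁻¹ * Real.exp (β * ‖v‖ ^ 2) := h1
      _ ≤ β⁻¹ * (Real.exp (-β * x) * Real.exp (2 * β * ‖v‖ ^ 2)) :=
          mul_le_mul_of_nonneg_left h2 (inv_nonneg.2 hβ.le)
      _ = β⁻¹ * Real.exp (-β * x) * Real.exp (2 * β * ‖v‖ ^ 2) := by ring
  · rw [Set.indicator_of_notMem (show v ∉ {v : V3 | x ≤ ‖v‖ ^ 2} from hv), ENNReal.ofReal_zero]
    exact bot_le

/-- Chernoff's pointwise bound for the total kinetic energy of a configuration: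
`𝟙{a ≤ ∑ₗ ‖vₗ‖²} ≤ e^{−αa} ∏ₗ e^{α‖vₗ‖²}` in `ℝ≥0∞` (`α ≥ 0`). [folklore] -/
theorem indicator_totalEnergy_le_prod_exp {N : ℕ} {α : ℝ} (hα : 0 ≤ α) (a : ℝ)
    (z : Config (N + 1) (Fin 3) T3) :
    Set.indicator {z : Config (N + 1) (Fin 3) T3 | a ≤ ∑ l, ‖(z l).2‖ ^ 2} 1 z ≤
      ENNReal.ofReal (Real.exp (-α * a)) *
        ∏ l : Fin (N + 1), ENNReal.ofReal (Real.exp (α * ‖(z l).2‖ ^ 2)) := by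
  by_cases hz : a ≤ ∑ l, ‖(z l).2‖ ^ 2
  · rw [Set.indicator_of_mem
        (show z ∈ {z : Config (N + 1) (Fin 3) T3 | a ≤ ∑ l, ‖(z l).2‖ ^ 2} from hz),
      Pi.one_apply, ← ENNReal.ofReal_prod_of_nonneg fun l _ => (Real.exp_pos _).le,
      ← Real.exp_sum, ← ENNReal.ofReal_mul (Real.exp_pos _).le, ← Real.exp_add, ← Finset.mul_sum]
    refine ENNReal.one_le_ofReal.2 (Real.one_le_exp ?_)
    nlinarith [mul_le_mul_of_nonneg_left hz hα]
  · rw [Set.indicator_of_notMem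
        (show z ∉ {z : Config (N + 1) (Fin 3) T3 | a ≤ ∑ l, ‖(z l).2‖ ^ 2} from hz)]
    exact bot_le

/-- The scalar bookkeeping of clause (2): for `K ≥ 0`, `α₀ > 0`, `x ≥ 0`,
`e^{−α₀ (K/α₀ (N+1) + x)} K^{N+1} ≤ e^{−(α₀/2) x}` (`K ≤ e^{K}`). [folklore] -/
theorem exp_neg_mul_budget_mul_pow_le {K α₀ x : ℝ} (hK : 0 ≤ K) (hα : 0 < α₀) (hx : 0 ≤ x) (N : ℕ) :
    Real.exp (-α₀ * (K / α₀ * ((N : ℝ) + 1) + x)) * K ^ (N + 1) ≤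
      Real.exp (-(α₀ / 2) * x) := by
  have hKexp : K ^ (N + 1) ≤ Real.exp (K * ((N : ℝ) + 1)) := by
    calc K ^ (N + 1) ≤ Real.exp K ^ (N + 1) :=
          pow_le_pow_left₀ hK (by linarith [Real.add_one_le_exp K]) _
      _ = Real.exp (K * ((N : ℝ) + 1)) := by
          rw [← Real.exp_nat_mul]; congr 1; push_cast; ring
  have h1 : -α₀ * (K / α₀ * ((N : ℝ) + 1) + x) + K * ((N : ℝ) + 1) = -α₀ * x := by
    field_simp
    ring
  calc Real.exp (-α₀ * (K / α₀ * ((N : ℝ) + 1) + x)) * K ^ (N + 1)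
      ≤ Real.exp (-α₀ * (K / α₀ * ((N : ℝ) + 1) + x)) * Real.exp (K * ((N : ℝ) + 1)) :=
        mul_le_mul_of_nonneg_left hKexp (Real.exp_pos _).le
    _ = Real.exp (-α₀ * x) := by rw [← Real.exp_add, h1]
    _ ≤ Real.exp (-(α₀ / 2) * x) := Real.exp_le_exp.2 (by nlinarith [mul_nonneg hα.le hx])

/-! ## The registered stub -/

/-- **Registered stub `stub_initialEnergyTails` — Gaussian facts of the data (`t = 0`).**  With the
exponential velocity moments `α₀ > 0`, `K ≥ 1` of `exists_expMoment_localGibbsLaw` (uniform in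
`σ ≤ 1/2`, `N`, `Φ`): `Θ* = 2/α₀`, `ē = K/α₀`, `C = 2K/α₀`; (0) from `‖v‖² ≤ α₀⁻¹e^{α₀‖v‖²}`,
(1) from `𝟙{x ≤ ‖v‖²}‖v‖² ≤ (2/α₀) e^{−α₀x/2} e^{α₀‖v‖²}`, (2) by Chernoff on the total energy
with the product moment `≤ K^{N+1}` and `K ≤ e^{K}`. [folklore] -/
theorem stub_initialEnergyTails : InitialEnergyTails := by
  intro a₀ θ₀ u₀ ha hθ hu ha0 hθ0
  obtain ⟨α₀, hα₀, K, hK1, hmom⟩ := exists_expMoment_localGibbsLaw ha hθ hu ha0 hθ0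
  have hK0 : 0 ≤ K := zero_le_one.trans hK1
  refine ⟨2 / α₀, by positivity, K / α₀, by positivity, 2 * K / α₀, by positivity,
    fun σ _hσ hσ2 N Φ x hx => ?_⟩
  obtain ⟨hpart, hprod⟩ := hmom σ hσ2 N Φ
  have hN : ((N + 1 : ℕ) : ℝ≥0∞) = ENNReal.ofReal ((N : ℝ) + 1) := by
    rw [show ((N : ℝ) + 1) = ((N + 1 : ℕ) : ℝ) by push_cast; ring, ENNReal.ofReal_natCast]
  have hmeas1 : ∀ i : Fin (N + 1), Measurable fun z : Config (N + 1) (Fin 3) T3 =>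
      ENNReal.ofReal (Real.exp (α₀ * ‖(z i).2‖ ^ 2)) := fun i =>
    (Real.measurable_exp.comp ((measurable_norm.pow_const 2).const_mul α₀)).ennreal_ofReal.comp
      (measurable_pi_apply i).snd
  have hexp : Real.exp (-x / (2 / α₀)) = Real.exp (-(α₀ / 2) * x) := by
    congr 1
    field_simp
  refine ⟨?_, ?_, ?_⟩
  · -- (0) mean kinetic energy
    calc ∫⁻ z, ENNReal.ofReal (∑ l, ‖(z l).2‖ ^ 2) ∂(localGibbsLaw σ a₀ u₀ θ₀ N Φ)
        ≤ ∫⁻ z, ∑ l, ENNReal.ofReal α₀⁻¹ * ENNReal.ofReal (Real.exp (α₀ * ‖(z l).2‖ ^ 2))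
            ∂(localGibbsLaw σ a₀ u₀ θ₀ N Φ) := by
          refine lintegral_mono fun z => ?_
          rw [ENNReal.ofReal_sum_of_nonneg fun i _ => sq_nonneg _]
          exact Finset.sum_le_sum fun i _ => ofReal_le_inv_mul_exp hα₀ _
      _ = ∑ l, ENNReal.ofReal α₀⁻¹ * ∫⁻ z, ENNReal.ofReal (Real.exp (α₀ * ‖(z l).2‖ ^ 2))
            ∂(localGibbsLaw σ a₀ u₀ θ₀ N Φ) := by
          rw [lintegral_finsetSum _ fun i _ => (hmeas1 i).const_mul _]
          exact Finset.sum_congr rfl fun i _ => lintegral_const_mul _ (hmeas1 i)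
      _ ≤ ∑ _l : Fin (N + 1), ENNReal.ofReal α₀⁻¹ * ENNReal.ofReal K :=
          Finset.sum_le_sum fun i _ => mul_le_mul_right (hpart i) _
      _ = ENNReal.ofReal (K / α₀ * ((N : ℝ) + 1)) := by
          rw [Finset.sum_const, Finset.card_univ, Fintype.card_fin, nsmul_eq_mul, hN,
            ← ENNReal.ofReal_mul (inv_nonneg.2 hα₀.le), ← ENNReal.ofReal_mul (by positivity)]
          congr 1
          rw [div_eq_inv_mul]
          ring
  · -- (1) tail energy above the level `x`
    have hβ : 0 < α₀ / 2 := by positivity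
    have h2 : ∀ v : V3, Real.exp (2 * (α₀ / 2) * ‖v‖ ^ 2) = Real.exp (α₀ * ‖v‖ ^ 2) := fun v => by
      congr 1
      ring
    calc ∫⁻ z, ENNReal.ofReal (∑ l, Set.indicator {v : V3 | x ≤ ‖v‖ ^ 2} (fun v => ‖v‖ ^ 2)
            ((z l).2)) ∂(localGibbsLaw σ a₀ u₀ θ₀ N Φ)
        ≤ ∫⁻ z, ∑ l, ENNReal.ofReal ((α₀ / 2)⁻¹ * Real.exp (-(α₀ / 2) * x)) *
            ENNReal.ofReal (Real.exp (α₀ * ‖(z l).2‖ ^ 2)) ∂(localGibbsLaw σ a₀ u₀ θ₀ N Φ) := by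
          refine lintegral_mono fun z => ?_
          rw [ENNReal.ofReal_sum_of_nonneg fun i _ =>
            Set.indicator_nonneg (fun v _ => sq_nonneg ‖v‖) _]
          refine Finset.sum_le_sum fun i _ => ?_
          rw [← h2]
          exact ofReal_indicator_tail_le_exp hβ x _
      _ = ∑ l, ENNReal.ofReal ((α₀ / 2)⁻¹ * Real.exp (-(α₀ / 2) * x)) *
            ∫⁻ z, ENNReal.ofReal (Real.exp (α₀ * ‖(z l).2‖ ^ 2))
              ∂(localGibbsLaw σ a₀ u₀ θ₀ N Φ) := by
          rw [lintegral_finsetSum _ fun i _ => (hmeas1 i).const_mul _]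
          exact Finset.sum_congr rfl fun i _ => lintegral_const_mul _ (hmeas1 i)
      _ ≤ ∑ _l : Fin (N + 1), ENNReal.ofReal ((α₀ / 2)⁻¹ * Real.exp (-(α₀ / 2) * x)) *
            ENNReal.ofReal K :=
          Finset.sum_le_sum fun i _ => mul_le_mul_right (hpart i) _
      _ = ENNReal.ofReal (2 * K / α₀ * ((N : ℝ) + 1) * Real.exp (-x / (2 / α₀))) := by
          rw [Finset.sum_const, Finset.card_univ, Fintype.card_fin, nsmul_eq_mul, hN, hexp,
            ← ENNReal.ofReal_mul (by positivity), ← ENNReal.ofReal_mul (by positivity)]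
          congr 1
          field_simp
  · -- (2) Chernoff for the total kinetic energy
    have hS : MeasurableSet {z : Config (N + 1) (Fin 3) T3 |
        K / α₀ * ((N : ℝ) + 1) + x ≤ ∑ l, ‖(z l).2‖ ^ 2} :=
      measurableSet_le measurable_const
        (Finset.measurable_sum _ fun l _ => ((measurable_pi_apply l).snd.norm).pow_const 2)
    have hmeasP : Measurable fun z : Config (N + 1) (Fin 3) T3 =>
        ∏ j : Fin (N + 1), ENNReal.ofReal (Real.exp (α₀ * ‖(z j).2‖ ^ 2)) :=
      Finset.measurable_prod _ fun j _ => hmeas1 j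
    calc (localGibbsLaw σ a₀ u₀ θ₀ N Φ) {z | K / α₀ * ((N : ℝ) + 1) + x ≤ ∑ l, ‖(z l).2‖ ^ 2}
        = ∫⁻ z, Set.indicator {z : Config (N + 1) (Fin 3) T3 |
            K / α₀ * ((N : ℝ) + 1) + x ≤ ∑ l, ‖(z l).2‖ ^ 2} 1 z
            ∂(localGibbsLaw σ a₀ u₀ θ₀ N Φ) := (lintegral_indicator_one hS).symm
      _ ≤ ∫⁻ z, ENNReal.ofReal (Real.exp (-α₀ * (K / α₀ * ((N : ℝ) + 1) + x))) *
            ∏ l, ENNReal.ofReal (Real.exp (α₀ * ‖(z l).2‖ ^ 2))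
            ∂(localGibbsLaw σ a₀ u₀ θ₀ N Φ) :=
          lintegral_mono fun z => indicator_totalEnergy_le_prod_exp hα₀.le _ z
      _ = ENNReal.ofReal (Real.exp (-α₀ * (K / α₀ * ((N : ℝ) + 1) + x))) *
            ∫⁻ z, ∏ l, ENNReal.ofReal (Real.exp (α₀ * ‖(z l).2‖ ^ 2))
              ∂(localGibbsLaw σ a₀ u₀ θ₀ N Φ) :=
          lintegral_const_mul _ hmeasP
      _ ≤ ENNReal.ofReal (Real.exp (-α₀ * (K / α₀ * ((N : ℝ) + 1) + x))) *
            ENNReal.ofReal (K ^ (N + 1)) :=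
          mul_le_mul_right hprod _
      _ = ENNReal.ofReal (Real.exp (-α₀ * (K / α₀ * ((N : ℝ) + 1) + x)) * K ^ (N + 1)) :=
          (ENNReal.ofReal_mul (Real.exp_pos _).le).symm
      _ ≤ ENNReal.ofReal (Real.exp (-x / (2 / α₀))) := by
          rw [hexp]
          exact ENNReal.ofReal_le_ofReal (exp_neg_mul_budget_mul_pow_le hK0 hα₀ hx N)

end Summit.AtomisticToContinuum.HydrodynamicLimit.Theorems.EnergyCurrentTailsPedigree
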